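import Literature.MathematicalPhysics.QuantumFieldTheory.Balaban1983to89.Beta.SliceComposition

/-!
# `BalabanUV.Beta.FP.ComposedSliceGhostFactor` — road «FP» for binder row D1, (STEP) door ∕ design row GHOST-STEP, owner module gen 14:
# THE LINEARISED FADDEEV–POPOV DETERMINANT OF THE COMPOSED SLICE FACTORISES — `det(τ̃·[W₂|W₁]) = det(τ₁W₁) · det(τ₂·Q₁W₂♮)` with
# `W₂♮ := W₂ − W₁(τ₁W₁)⁻¹τ₁W₂` the composite null directions ON the fine slice and `Q₁W₂♮` NULL DIRECTIONS OF THE BLOCK FORM `𝒮₁₁`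
# BLIND TO `Q₂` — hence an5's `det_kkt_comp_sliceChange` WITHOUT UNIPOTENCY: **THE GHOST-DRESSED ONE-LOOP DETERMINANT COMPOSES
# EXACTLY IN ARBITRARY TRANSVERSAL SLICES**, `det kkt(K,[Q₂Q₁;P])·det(τ₁W₁)²·det(τ₂Q₁W₂♮)² = (−1)^{|μ|}·det kkt(K,[Q₁;τ₁])·det kkt(𝒮₁₁,[Q₂;τ₂])·det(P[W₂|W₁])²`,
# in words (over `ℝ`, logarithms): `log|det kkt_P| − 2·log|det PW| = (log|det kkt₁| − 2·log|det τ₁W₁|) + (log|det kkt₂| − 2·log|det τ₂W^c|)`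

HONEST DEPENDENCY (page 1, mandatory): continuum YM on T⁴ ⇐ BetaPertH ∧ nine spine estimates (0/9 proved); BetaPertH ⇐ (D1) ∧ (D4) ∧ CAP+tail;
G-an2-4 gates asym, D1 and NE2/3/4.  HONEST FRAMING (cell contract, verbatim): «discharging `BetaPertH` makes Bałaban's UV stability UNCONDITIONAL —
a real constructive-QFT result; it is NOT the continuum limit and NOT the Clay problem.»  THIS MODULE DISCHARGES NOTHING of the wall: it is [folklore]
finite-dimensional linear algebra over an arbitrary field (one Schur-complement determinant, the block identities of the bordered inverse) composed BY NAME
with an5's `SliceComposition.det_kkt_comp_sliceChange` and `CompositionSingular.blocks_mul_kkt` ∕ `kkt_mul_blocks`.  No `def`, no `def … : Prop`, nothing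
cited, 0 sorry; 0∕4 row-D1 binders; NOT SDF for the literal (the dictionary from road FP's perfect objects to `(K, Q₁, τ₁, Q₂, τ₂, W, P)` is ROW (β) of
`N2B-DESIGN.md` §5 (d), not in this file), NOT D1, NOT BetaPertH, NOT continuum, NOT Clay.  «not in print; our bookkeeping».

ABSOLUTE RULE (cell charter, verbatim): «No internally-minted statement may enter as a cited fact. Every hypothesis is either kernel-proved in this package or a
verbatim quotation of a PUBLISHED theorem with page reference. The manuscript(s) under audit are NOT citable for their own disputed steps — they are the thing
under adjudication; programme-internal (2001/route/tribunal) claims are never citable.»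

WHY (owner memo `HOME/b2b-balaban-beta-d1-p3/N2B-DESIGN.md` v2 §9, gen 14).  an5's §7 (`SliceComposition.det_kkt_comp_sliceChange`): the one-shot fluctuation
determinant in a slice `P` equals the product of the two step determinants (composed slice `τ̃ = [τ₂Q₁; τ₁]`) up to the linearised Faddeev–Popov quotient
`det(PW)²/det(τ̃W)²`; for UNIPOTENT (forest∕axial) slices the quotient is `1` and the step defect of the determinant is zero (`det_kkt_comp_sliceChange_of_unipotent`).
Road FP's typed slices are NOT unipotent against background-dependent gauge directions `W(b)`; the located reading of the END's `hSDF` (memo §5 (c)) is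
exactly «the second `b`-jet of `log` of that quotient».  This file shows what the quotient IS at the composite level: `det(τ̃W)` is the fine step's own
Faddeev–Popov determinant `det(τ₁W₁)` times the block step's own Faddeev–Popov determinant `det(τ₂W^c)` on the DESCENDED gauge directions
`W^c = Q₁W₂♮` — which are honest null directions of the block form `𝒮₁₁` blind to the next averaging `Q₂`, so that the block factor is the
coarse system's own quotient datum and the identity iterates level by level.  Consequently the GHOST-DRESSED determinant `det kkt(K,[Q;S]) / det(SW)²`
has ZERO step defect in ANY transversal slices — the honest form of (SDF) at the Gaussian∕one-loop level, of which the typed gluon-only `hSDF` is the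
special case «the quotient's second `b`-jet has vanishing `(μ,ν)` second moment».

CONTENTS (all [folklore]; setting of `SliceComposition` §7: `K : Matrix ν ν 𝕜` with two-sided null directions, first averaging `Q₁ : Matrix μ ν 𝕜`, fine
slice `τ₁ : Matrix ρ₁ ν 𝕜`, second averaging `Q₂ : Matrix κ μ 𝕜`, block slice `τ₂ : Matrix ρ₂ μ 𝕜`, `𝒮₁₁ := (effForm K [Q₁;τ₁]).toBlocks₁₁`; the composite null
directions are given in two column blocks `[W₂ | W₁]`, `W₁ : Matrix ν ρ₁ 𝕜` the fine step's own (`Q₁W₁ = 0`, `τ₁W₁` invertible), `W₂ : Matrix ν ρ₂ 𝕜` any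
completion (`KW₂ = 0`, `Q₂Q₁W₂ = 0`)).
* §1 `effForm_mul_constraint_mul_null` ∕ `effForm_transpose_mul_constraint_mul_null`: for ANY constraint `C` with `kkt K C` invertible and any `w` with
  `Kw = 0` (resp. `Kᵀw = 0`), `𝒮(K,C)·(Cw) = 0` (resp. `𝒮ᵀ·(Cw) = 0`) — the effective form kills the constraint images of null directions (the
  «gauge-invariant extension» read at the level of the bordered inverse: `ℋᴸK = 𝒮C`, `Kℋ = Cᵀ𝒮`).
* §2 the reduced directions `W₂♮ := W₂ − W₁·((τ₁W₁)⁻¹·(τ₁W₂))`: `τ₁W₂♮ = 0`, `KW₂♮ = 0`, `KᵀW₂♮ = 0`, `Q₂Q₁W₂♮ = 0`, and — the point —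
  `𝒮₁₁·(Q₁W₂♮) = 0`, `𝒮₁₁ᵀ·(Q₁W₂♮) = 0` (`coarse_null`, `coarse_null_transpose`, `coarse_blind`): the descended directions are two-sided null directions of
  the block form blind to `Q₂`, i.e. EXACTLY the data an5's theorems ask of the block step; under `Q₁W₁ = 0`, `Q₁W₂♮ = Q₁W₂` (`descend_eq`).
* §3 `det_composedSlice_mul`: `det(fromRows (τ₂Q₁) τ₁ · fromCols W₂ W₁) = det(τ₁W₁) · det(τ₂·(Q₁W₂♮))` (Schur complement around the invertible corner
  `τ₁W₁`, Mathlib `det_fromBlocks₂₂`); `isUnit_det_composedSlice_mul` (the composed slice is transversal iff both factors are).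
* §4 **`det_kkt_comp_ghostDressed`**: an5's `det_kkt_comp_sliceChange` with `det(τ̃W)` FACTORISED — no unipotency hypothesis; **`log_abs_det_kkt_comp_ghostDressed`**
  (over `ℝ`): `log|det kkt(K,[Q₂Q₁;P])| − 2·log|det(P·[W₂|W₁])| = (log|det kkt(K,[Q₁;τ₁])| − 2·log|det(τ₁W₁)|) + (log|det kkt(𝒮₁₁,[Q₂;τ₂])| − 2·log|det(τ₂·Q₁W₂)|)`
  — read with `−½`: the GHOST-DRESSED `log Z` of the one-shot integration IS the sum of the ghost-dressed `log Z`'s of the two steps, WHATEVER transversal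
  slices `P`, `τ₁`, `τ₂` are used; as an identity between real-valued functions of any background parameter on which `K`, the `W`'s (and the slices) may
  depend, it holds jet by jet: the ghost-dressed polarization has zero step defect as a KERNEL.
Provenance: road FP OWNER b2b-balaban-beta-d1-p3 gen 14 (prover-b2b-balaban-beta-d1-p3-g14-0), 2026-08-21; design row GHOST-STEP (LEAVES-FP), memo
`N2B-DESIGN.md` v2 §9.  Orientation only (nothing quoted is load-bearing): the Faddeev–Popov bookkeeping of composed versus one-shot gauge conditions is the
subject of [Balaban1987RG1] §1 (1.1)–(1.22) pp. 255–264 (composition of the renormalization transformations) read together with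
[Balaban1985BackgroundPropagators] Sect. D (the slice `δ_R(RD*A)`, (3.110)–(3.126)); this file's content is textbook linear algebra.
-/

namespace Summit.QuantumFields.BalabanUV.Beta.FP.ComposedSliceGhostFactor

noncomputable section

open Literature.MathematicalPhysics.QuantumFieldTheory.Balaban1983to89.Beta.Composition
open Literature.MathematicalPhysics.QuantumFieldTheory.Balaban1983to89.Beta.CompositionSingular
open Literature.MathematicalPhysics.QuantumFieldTheory.Balaban1983to89.Beta.SliceComposition
open scoped Matrix
open Matrix

variable {𝕜 : Type*} [Field 𝕜]
variable {ν μ κ ρ₁ ρ₂ : Type*} [Fintype ν] [Fintype μ] [Fintype κ] [Fintype ρ₁] [Fintype ρ₂]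
  [DecidableEq ν] [DecidableEq μ] [DecidableEq κ] [DecidableEq ρ₁] [DecidableEq ρ₂]

/-! ## §1 The effective form kills the constraint images of null directions -/

section Null

variable {μ' σ : Type*} [Fintype μ'] [DecidableEq μ']

/-- [folklore] **THE EFFECTIVE FORM KILLS CONSTRAINT IMAGES OF NULL DIRECTIONS.**  For any constraint `C` with `kkt K C` invertible and any family of
columns `w` with `K·w = 0`: `𝒮(K,C)·(C·w) = 0` (from the block identity `ℋᴸ·K = 𝒮·C` of `CompositionSingular.blocks_mul_kkt`). -/
theorem effForm_mul_constraint_mul_null (K : Matrix ν ν 𝕜) (C : Matrix μ' ν 𝕜) (w : Matrix ν σ 𝕜) (hKw : K * w = 0)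
    (h : IsUnit (kkt K C).det) : effForm K C * (C * w) = 0 := by
  rw [← Matrix.mul_assoc, ← (blocks_mul_kkt K C h).2.2.1, Matrix.mul_assoc, hKw, Matrix.mul_zero]

/-- [folklore] … and `𝒮(K,C)ᵀ·(C·w) = 0` whenever `Kᵀ·w = 0` (from `K·ℋ = Cᵀ·𝒮` of `CompositionSingular.kkt_mul_blocks`, transposed). -/
theorem effForm_transpose_mul_constraint_mul_null (K : Matrix ν ν 𝕜) (C : Matrix μ' ν 𝕜) (w : Matrix ν σ 𝕜) (hKtw : Kᵀ * w = 0)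
    (h : IsUnit (kkt K C).det) : (effForm K C)ᵀ * (C * w) = 0 := by
  have h12 : K * minOp K C = Cᵀ * effForm K C := (kkt_mul_blocks K C h).2.1
  have ht : (minOp K C)ᵀ * Kᵀ = (effForm K C)ᵀ * C := by
    have e := congrArg Matrix.transpose h12
    rw [Matrix.transpose_mul, Matrix.transpose_mul, Matrix.transpose_transpose] at e
    exact e
  rw [← Matrix.mul_assoc, ← ht, Matrix.mul_assoc, hKtw, Matrix.mul_zero]

end Null

/-! ## §2 The composite null directions reduced onto the fine slice, and their descent to the block variable -/

section Descend

omit [Fintype ρ₂] [DecidableEq ν] [DecidableEq ρ₂] in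
/-- [folklore] The reduced directions `W₂♮ := W₂ − W₁·((τ₁W₁)⁻¹·(τ₁W₂))` satisfy the fine slice: `τ₁·W₂♮ = 0`. -/
theorem slice_mul_reduced (τ₁ : Matrix ρ₁ ν 𝕜) (W₁ : Matrix ν ρ₁ 𝕜) (W₂ : Matrix ν ρ₂ 𝕜) (hT : IsUnit (τ₁ * W₁).det) :
    τ₁ * (W₂ - W₁ * ((τ₁ * W₁)⁻¹ * (τ₁ * W₂))) = 0 := by
  rw [Matrix.mul_sub, ← Matrix.mul_assoc, ← Matrix.mul_assoc, Matrix.mul_nonsing_inv _ hT, Matrix.one_mul, sub_self]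

omit [Fintype ρ₂] [DecidableEq ν] [DecidableEq ρ₂] in
/-- [folklore] `K·W₂♮ = 0` when `K·W₁ = 0` and `K·W₂ = 0`. -/
theorem form_mul_reduced (K : Matrix ν ν 𝕜) (τ₁ : Matrix ρ₁ ν 𝕜) (W₁ : Matrix ν ρ₁ 𝕜) (W₂ : Matrix ν ρ₂ 𝕜) (hKW₁ : K * W₁ = 0)
    (hKW₂ : K * W₂ = 0) : K * (W₂ - W₁ * ((τ₁ * W₁)⁻¹ * (τ₁ * W₂))) = 0 := by
  rw [Matrix.mul_sub, ← Matrix.mul_assoc, hKW₁, hKW₂, Matrix.zero_mul, sub_self]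

omit [Fintype ρ₂] [DecidableEq ν] [DecidableEq ρ₂] in
/-- [folklore] `Kᵀ·W₂♮ = 0` when `Kᵀ·W₁ = 0` and `Kᵀ·W₂ = 0`. -/
theorem form_transpose_mul_reduced (K : Matrix ν ν 𝕜) (τ₁ : Matrix ρ₁ ν 𝕜) (W₁ : Matrix ν ρ₁ 𝕜) (W₂ : Matrix ν ρ₂ 𝕜)
    (hKtW₁ : Kᵀ * W₁ = 0) (hKtW₂ : Kᵀ * W₂ = 0) : Kᵀ * (W₂ - W₁ * ((τ₁ * W₁)⁻¹ * (τ₁ * W₂))) = 0 :=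
  form_mul_reduced Kᵀ τ₁ W₁ W₂ hKtW₁ hKtW₂

omit [Fintype μ] [Fintype ρ₂] [DecidableEq ν] [DecidableEq μ] [DecidableEq ρ₂] in
/-- [folklore] Under `Q₁·W₁ = 0` the descended directions do not see the reduction: `Q₁·W₂♮ = Q₁·W₂` (`descend_eq`). -/
theorem descend_eq (Q₁ : Matrix μ ν 𝕜) (τ₁ : Matrix ρ₁ ν 𝕜) (W₁ : Matrix ν ρ₁ 𝕜) (W₂ : Matrix ν ρ₂ 𝕜) (hQW₁ : Q₁ * W₁ = 0) :
    Q₁ * (W₂ - W₁ * ((τ₁ * W₁)⁻¹ * (τ₁ * W₂))) = Q₁ * W₂ := by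
  rw [Matrix.mul_sub, ← Matrix.mul_assoc, hQW₁, Matrix.zero_mul, sub_zero]

omit [Fintype κ] [DecidableEq κ] [Fintype ρ₂] [DecidableEq ν] [DecidableEq μ] [DecidableEq ρ₂] in
/-- [folklore] **THE DESCENDED DIRECTIONS ARE BLIND TO THE NEXT AVERAGING**: `Q₂·(Q₁·W₂♮) = 0` when `Q₂Q₁W₂ = 0` and `Q₁W₁ = 0` (`coarse_blind`). -/
theorem coarse_blind (Q₁ : Matrix μ ν 𝕜) (τ₁ : Matrix ρ₁ ν 𝕜) (W₁ : Matrix ν ρ₁ 𝕜) (Q₂ : Matrix κ μ 𝕜) (W₂ : Matrix ν ρ₂ 𝕜)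
    (hQW₁ : Q₁ * W₁ = 0) (hQQW₂ : Q₂ * (Q₁ * W₂) = 0) :
    Q₂ * (Q₁ * (W₂ - W₁ * ((τ₁ * W₁)⁻¹ * (τ₁ * W₂)))) = 0 := by
  rw [descend_eq Q₁ τ₁ W₁ W₂ hQW₁, hQQW₂]

omit [Fintype μ] [DecidableEq μ] [Fintype ρ₂] [DecidableEq ν] [DecidableEq ρ₂] in
/-- [folklore] The sliced constraint `[Q₁;τ₁]` maps the reduced directions to `[Q₁W₂♮; 0]`. -/
theorem fromRows_mul_reduced (Q₁ : Matrix μ ν 𝕜) (τ₁ : Matrix ρ₁ ν 𝕜) (W₁ : Matrix ν ρ₁ 𝕜) (W₂ : Matrix ν ρ₂ 𝕜)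
    (hT : IsUnit (τ₁ * W₁).det) :
    fromRows Q₁ τ₁ * (W₂ - W₁ * ((τ₁ * W₁)⁻¹ * (τ₁ * W₂))) =
      fromRows (Q₁ * (W₂ - W₁ * ((τ₁ * W₁)⁻¹ * (τ₁ * W₂)))) (0 : Matrix ρ₁ ρ₂ 𝕜) := by
  rw [fromRows_mul, slice_mul_reduced τ₁ W₁ W₂ hT]

omit [Fintype ρ₂] [DecidableEq ρ₂] in
/-- [folklore] **THE DESCENDED DIRECTIONS ARE NULL DIRECTIONS OF THE BLOCK FORM**: `𝒮₁₁·(Q₁·W₂♮) = 0` (`𝒮₁₁ = (effForm K [Q₁;τ₁]).toBlocks₁₁`),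
given `KW₁ = 0`, `KW₂ = 0`, `τ₁W₁` invertible and the fine sliced system invertible (§1 at `C := [Q₁;τ₁]`, `w := W₂♮`; the block row of a product with
`[X; 0]`). -/
theorem coarse_null (K : Matrix ν ν 𝕜) (Q₁ : Matrix μ ν 𝕜) (τ₁ : Matrix ρ₁ ν 𝕜) (W₁ : Matrix ν ρ₁ 𝕜) (W₂ : Matrix ν ρ₂ 𝕜)
    (hKW₁ : K * W₁ = 0) (hKW₂ : K * W₂ = 0) (hT : IsUnit (τ₁ * W₁).det) (h1 : IsUnit (kkt K (fromRows Q₁ τ₁)).det) :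
    (effForm K (fromRows Q₁ τ₁)).toBlocks₁₁ * (Q₁ * (W₂ - W₁ * ((τ₁ * W₁)⁻¹ * (τ₁ * W₂)))) = 0 := by
  have h := effForm_mul_constraint_mul_null K (fromRows Q₁ τ₁) _ (form_mul_reduced K τ₁ W₁ W₂ hKW₁ hKW₂) h1
  rw [fromRows_mul_reduced Q₁ τ₁ W₁ W₂ hT, ← fromBlocks_toBlocks (effForm K (fromRows Q₁ τ₁)), fromBlocks_mul_fromRows,
    Matrix.mul_zero, Matrix.mul_zero, add_zero, add_zero, ← fromRows_zero] at h
  exact (fromRows_inj h).1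

omit [Fintype ρ₂] [DecidableEq ρ₂] in
/-- [folklore] … and `𝒮₁₁ᵀ·(Q₁·W₂♮) = 0`, given `KᵀW₁ = 0`, `KᵀW₂ = 0` (two-sided null directions descend to two-sided null directions). -/
theorem coarse_null_transpose (K : Matrix ν ν 𝕜) (Q₁ : Matrix μ ν 𝕜) (τ₁ : Matrix ρ₁ ν 𝕜) (W₁ : Matrix ν ρ₁ 𝕜) (W₂ : Matrix ν ρ₂ 𝕜)
    (hKtW₁ : Kᵀ * W₁ = 0) (hKtW₂ : Kᵀ * W₂ = 0) (hT : IsUnit (τ₁ * W₁).det) (h1 : IsUnit (kkt K (fromRows Q₁ τ₁)).det) :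
    ((effForm K (fromRows Q₁ τ₁)).toBlocks₁₁)ᵀ * (Q₁ * (W₂ - W₁ * ((τ₁ * W₁)⁻¹ * (τ₁ * W₂)))) = 0 := by
  have h := effForm_transpose_mul_constraint_mul_null K (fromRows Q₁ τ₁) _ (form_transpose_mul_reduced K τ₁ W₁ W₂ hKtW₁ hKtW₂) h1
  rw [fromRows_mul_reduced Q₁ τ₁ W₁ W₂ hT, ← fromBlocks_toBlocks (effForm K (fromRows Q₁ τ₁)), fromBlocks_transpose,
    fromBlocks_mul_fromRows, Matrix.mul_zero, Matrix.mul_zero, add_zero, add_zero, ← fromRows_zero] at h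
  exact (fromRows_inj h).1

end Descend

/-! ## §3 The determinant of the composed slice on the composite null directions FACTORISES -/

section Factor

omit [DecidableEq ν] [DecidableEq μ] in
/-- [folklore] **`det(τ̃·[W₂|W₁]) = det(τ₁W₁) · det(τ₂·Q₁W₂♮)`** for the composed slice `τ̃ = fromRows (τ₂Q₁) τ₁` and composite null directions given in the
column blocks `fromCols W₂ W₁` with `τ₁W₁` invertible: the Schur complement of the corner `τ₁W₁` in `τ̃·[W₂|W₁] = [[τ₂Q₁W₂, τ₂Q₁W₁],[τ₁W₂, τ₁W₁]]` is
`τ₂·Q₁·(W₂ − W₁(τ₁W₁)⁻¹τ₁W₂) = τ₂·Q₁W₂♮` — the block slice applied to the DESCENDED directions.  (No hypothesis on `K`, `Q₂` or `Q₁W₁`.) -/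
theorem det_composedSlice_mul (Q₁ : Matrix μ ν 𝕜) (τ₁ : Matrix ρ₁ ν 𝕜) (τ₂ : Matrix ρ₂ μ 𝕜) (W₁ : Matrix ν ρ₁ 𝕜) (W₂ : Matrix ν ρ₂ 𝕜)
    (hT : IsUnit (τ₁ * W₁).det) :
    (fromRows (τ₂ * Q₁) τ₁ * fromCols W₂ W₁).det =
      (τ₁ * W₁).det * (τ₂ * (Q₁ * (W₂ - W₁ * ((τ₁ * W₁)⁻¹ * (τ₁ * W₂))))).det := by
  letI : Invertible (τ₁ * W₁) := Matrix.invertibleOfIsUnitDet _ hT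
  rw [fromRows_mul_fromCols, det_fromBlocks₂₂, invOf_eq_nonsing_inv]
  congr 2
  simp only [Matrix.mul_sub, Matrix.mul_assoc]

omit [DecidableEq ν] [DecidableEq μ] in
/-- [folklore] Under `Q₁W₁ = 0`: `det(τ̃·[W₂|W₁]) = det(τ₁W₁) · det(τ₂·Q₁W₂)` (block-triangular case). -/
theorem det_composedSlice_mul_of_blind (Q₁ : Matrix μ ν 𝕜) (τ₁ : Matrix ρ₁ ν 𝕜) (τ₂ : Matrix ρ₂ μ 𝕜) (W₁ : Matrix ν ρ₁ 𝕜)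
    (W₂ : Matrix ν ρ₂ 𝕜) (hQW₁ : Q₁ * W₁ = 0) (hT : IsUnit (τ₁ * W₁).det) :
    (fromRows (τ₂ * Q₁) τ₁ * fromCols W₂ W₁).det = (τ₁ * W₁).det * (τ₂ * (Q₁ * W₂)).det := by
  rw [det_composedSlice_mul Q₁ τ₁ τ₂ W₁ W₂ hT, descend_eq Q₁ τ₁ W₁ W₂ hQW₁]

omit [DecidableEq ν] [DecidableEq μ] in
/-- [folklore] The composed slice is transversal to `[W₂|W₁]` as soon as `τ₁W₁` and `τ₂·Q₁W₂` are invertible (`Q₁W₁ = 0`). -/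
theorem isUnit_det_composedSlice_mul (Q₁ : Matrix μ ν 𝕜) (τ₁ : Matrix ρ₁ ν 𝕜) (τ₂ : Matrix ρ₂ μ 𝕜) (W₁ : Matrix ν ρ₁ 𝕜) (W₂ : Matrix ν ρ₂ 𝕜)
    (hQW₁ : Q₁ * W₁ = 0) (hT : IsUnit (τ₁ * W₁).det) (hTc : IsUnit (τ₂ * (Q₁ * W₂)).det) :
    IsUnit (fromRows (τ₂ * Q₁) τ₁ * fromCols W₂ W₁).det := by
  rw [det_composedSlice_mul_of_blind Q₁ τ₁ τ₂ W₁ W₂ hQW₁ hT]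
  exact hT.mul hTc

end Factor

/-! ## §4 The ghost-dressed determinant composes exactly, in arbitrary transversal slices -/

section Dressed

omit [Fintype κ] [Fintype ρ₁] [Fintype ρ₂] [DecidableEq ν] [DecidableEq μ] [DecidableEq κ] [DecidableEq ρ₁] [DecidableEq ρ₂] in
/-- [folklore] The composite null directions assembled from the two column blocks are two-sided null directions of `K` blind to `Q₂Q₁`. -/
theorem null_fromCols (K : Matrix ν ν 𝕜) (Q₁ : Matrix μ ν 𝕜) (Q₂ : Matrix κ μ 𝕜) (W₁ : Matrix ν ρ₁ 𝕜) (W₂ : Matrix ν ρ₂ 𝕜)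
    (hKW₁ : K * W₁ = 0) (hKtW₁ : Kᵀ * W₁ = 0) (hQW₁ : Q₁ * W₁ = 0) (hKW₂ : K * W₂ = 0) (hKtW₂ : Kᵀ * W₂ = 0)
    (hQQW₂ : Q₂ * (Q₁ * W₂) = 0) :
    K * fromCols W₂ W₁ = 0 ∧ Kᵀ * fromCols W₂ W₁ = 0 ∧ Q₂ * Q₁ * fromCols W₂ W₁ = 0 := by
  refine ⟨?_, ?_, ?_⟩
  · rw [mul_fromCols, hKW₂, hKW₁, fromCols_zero]
  · rw [mul_fromCols, hKtW₂, hKtW₁, fromCols_zero]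
  · rw [Matrix.mul_assoc, mul_fromCols, mul_fromCols, hQW₁, hQQW₂, Matrix.mul_zero, fromCols_zero]

/-- [folklore] **THE GHOST-DRESSED DETERMINANT COMPOSES EXACTLY (an5's `det_kkt_comp_sliceChange` with `det(τ̃W)` factorised; NO unipotency).**
Fine step `(K,[Q₁;τ₁])` with its own null directions `W₁` (`KW₁ = 0`, `KᵀW₁ = 0`, `Q₁W₁ = 0`, `τ₁W₁` invertible, bordered-invertible), block step
`(𝒮₁₁,[Q₂;τ₂])`, a completion `W₂` of the composite null directions (`KW₂ = 0`, `KᵀW₂ = 0`, `Q₂Q₁W₂ = 0`) on whose descent `Q₁W₂` the block slice is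
transversal, and ANY one-shot slice `P` transversal to `[W₂|W₁]`.  Then
`det kkt(K,[Q₂Q₁;P]) · (det(τ₁W₁)·det(τ₂·Q₁W₂))² = (−1)^{|μ|} · det kkt(K,[Q₁;τ₁]) · det kkt(𝒮₁₁,[Q₂;τ₂]) · det(P·[W₂|W₁])²`. -/
theorem det_kkt_comp_ghostDressed (K : Matrix ν ν 𝕜) (Q₁ : Matrix μ ν 𝕜) (τ₁ : Matrix ρ₁ ν 𝕜) (W₁ : Matrix ν ρ₁ 𝕜)
    (Q₂ : Matrix κ μ 𝕜) (τ₂ : Matrix ρ₂ μ 𝕜) (hKW₁ : K * W₁ = 0) (hKtW₁ : Kᵀ * W₁ = 0) (hQW₁ : Q₁ * W₁ = 0)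
    (hT : IsUnit (τ₁ * W₁).det) (h1 : IsUnit (kkt K (fromRows Q₁ τ₁)).det)
    (W₂ : Matrix ν ρ₂ 𝕜) (hKW₂ : K * W₂ = 0) (hKtW₂ : Kᵀ * W₂ = 0) (hQQW₂ : Q₂ * (Q₁ * W₂) = 0)
    (hTc : IsUnit (τ₂ * (Q₁ * W₂)).det) (P : Matrix (ρ₂ ⊕ ρ₁) ν 𝕜) (hS : IsUnit (P * fromCols W₂ W₁).det) :
    (kkt K (fromRows (Q₂ * Q₁) P)).det * ((τ₁ * W₁).det * (τ₂ * (Q₁ * W₂)).det) ^ 2 =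
      (-1) ^ Fintype.card μ * ((kkt K (fromRows Q₁ τ₁)).det *
        (kkt (effForm K (fromRows Q₁ τ₁)).toBlocks₁₁ (fromRows Q₂ τ₂)).det) * (P * fromCols W₂ W₁).det ^ 2 := by
  obtain ⟨hKW', hKtW', hQW'⟩ := null_fromCols K Q₁ Q₂ W₁ W₂ hKW₁ hKtW₁ hQW₁ hKW₂ hKtW₂ hQQW₂
  have h := det_kkt_comp_sliceChange K Q₁ τ₁ W₁ Q₂ τ₂ hKW₁ hKtW₁ hQW₁ hT h1 (fromCols W₂ W₁) P hKW' hKtW' hQW'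
    (isUnit_det_composedSlice_mul Q₁ τ₁ τ₂ W₁ W₂ hQW₁ hT hTc) hS
  rwa [det_composedSlice_mul_of_blind Q₁ τ₁ τ₂ W₁ W₂ hQW₁ hT] at h

/-- [folklore] Under the hypotheses of `det_kkt_comp_ghostDressed` and an invertible block system, the one-shot sliced system is invertible too. -/
theorem det_kkt_oneShot_ne_zero (K : Matrix ν ν 𝕜) (Q₁ : Matrix μ ν 𝕜) (τ₁ : Matrix ρ₁ ν 𝕜) (W₁ : Matrix ν ρ₁ 𝕜)
    (Q₂ : Matrix κ μ 𝕜) (τ₂ : Matrix ρ₂ μ 𝕜) (hKW₁ : K * W₁ = 0) (hKtW₁ : Kᵀ * W₁ = 0) (hQW₁ : Q₁ * W₁ = 0)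
    (hT : IsUnit (τ₁ * W₁).det) (h1 : IsUnit (kkt K (fromRows Q₁ τ₁)).det)
    (h2 : IsUnit (kkt (effForm K (fromRows Q₁ τ₁)).toBlocks₁₁ (fromRows Q₂ τ₂)).det)
    (W₂ : Matrix ν ρ₂ 𝕜) (hKW₂ : K * W₂ = 0) (hKtW₂ : Kᵀ * W₂ = 0) (hQQW₂ : Q₂ * (Q₁ * W₂) = 0)
    (hTc : IsUnit (τ₂ * (Q₁ * W₂)).det) (P : Matrix (ρ₂ ⊕ ρ₁) ν 𝕜) (hS : IsUnit (P * fromCols W₂ W₁).det) :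
    (kkt K (fromRows (Q₂ * Q₁) P)).det ≠ 0 := by
  intro h0
  have h := det_kkt_comp_ghostDressed K Q₁ τ₁ W₁ Q₂ τ₂ hKW₁ hKtW₁ hQW₁ hT h1 W₂ hKW₂ hKtW₂ hQQW₂ hTc P hS
  rw [h0, zero_mul] at h
  have hne : (-1 : 𝕜) ^ Fintype.card μ * ((kkt K (fromRows Q₁ τ₁)).det *
      (kkt (effForm K (fromRows Q₁ τ₁)).toBlocks₁₁ (fromRows Q₂ τ₂)).det) * (P * fromCols W₂ W₁).det ^ 2 ≠ 0 :=
    mul_ne_zero (mul_ne_zero (pow_ne_zero _ (neg_ne_zero.mpr one_ne_zero)) (mul_ne_zero h1.ne_zero h2.ne_zero))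
      (pow_ne_zero _ hS.ne_zero)
  exact hne h.symm

end Dressed

/-! ## §5 Over `ℝ`: the ghost-dressed `log|det|` of the one-shot system is the SUM of the two steps' ghost-dressed `log|det|` -/

section RealLog

variable {ν μ κ ρ₁ ρ₂ : Type*} [Fintype ν] [Fintype μ] [Fintype κ] [Fintype ρ₁] [Fintype ρ₂]
  [DecidableEq ν] [DecidableEq μ] [DecidableEq κ] [DecidableEq ρ₁] [DecidableEq ρ₂]

/-- [folklore] **THE GHOST-DRESSED `log|det|` COMPOSES ADDITIVELY, IN ARBITRARY TRANSVERSAL SLICES** (over `ℝ`):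
`log|det kkt(K,[Q₂Q₁;P])| − 2·log|det(P·[W₂|W₁])| = (log|det kkt(K,[Q₁;τ₁])| − 2·log|det(τ₁W₁)|) + (log|det kkt(𝒮₁₁,[Q₂;τ₂])| − 2·log|det(τ₂·Q₁W₂)|)`.
Multiplying by `−½`: the one-shot `log Z` dressed by its linearised Faddeev–Popov logarithm equals the sum of the two steps' dressed `log Z`'s — whatever
admissible slices are used at the three places.  Read as an identity between functions of a background parameter `b` on which `K`, `W₁`, `W₂` (and the
slices) depend, it holds for every `b`, hence for every `b`-jet: THE GHOST-DRESSED ONE-LOOP FUNCTIONAL HAS ZERO STEP DEFECT AS A KERNEL.  The gluon-only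
functional's step defect is therefore exactly (the jet of) `2·log|det(P·[W₂|W₁])| − 2·log|det(τ₁W₁)| − 2·log|det(τ₂·Q₁W₂)|` (road FP's located `D m`,
memo `N2B-DESIGN.md` §5 (c) ∕ §9). -/
theorem log_abs_det_kkt_comp_ghostDressed (K : Matrix ν ν ℝ) (Q₁ : Matrix μ ν ℝ) (τ₁ : Matrix ρ₁ ν ℝ) (W₁ : Matrix ν ρ₁ ℝ)
    (Q₂ : Matrix κ μ ℝ) (τ₂ : Matrix ρ₂ μ ℝ) (hKW₁ : K * W₁ = 0) (hKtW₁ : Kᵀ * W₁ = 0) (hQW₁ : Q₁ * W₁ = 0)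
    (hT : IsUnit (τ₁ * W₁).det) (h1 : IsUnit (kkt K (fromRows Q₁ τ₁)).det)
    (h2 : IsUnit (kkt (effForm K (fromRows Q₁ τ₁)).toBlocks₁₁ (fromRows Q₂ τ₂)).det)
    (W₂ : Matrix ν ρ₂ ℝ) (hKW₂ : K * W₂ = 0) (hKtW₂ : Kᵀ * W₂ = 0) (hQQW₂ : Q₂ * (Q₁ * W₂) = 0)
    (hTc : IsUnit (τ₂ * (Q₁ * W₂)).det) (P : Matrix (ρ₂ ⊕ ρ₁) ν ℝ) (hS : IsUnit (P * fromCols W₂ W₁).det) :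
    Real.log |(kkt K (fromRows (Q₂ * Q₁) P)).det| - 2 * Real.log |(P * fromCols W₂ W₁).det| =
      (Real.log |(kkt K (fromRows Q₁ τ₁)).det| - 2 * Real.log |(τ₁ * W₁).det|) +
        (Real.log |(kkt (effForm K (fromRows Q₁ τ₁)).toBlocks₁₁ (fromRows Q₂ τ₂)).det| - 2 * Real.log |(τ₂ * (Q₁ * W₂)).det|) := by
  have h := det_kkt_comp_ghostDressed K Q₁ τ₁ W₁ Q₂ τ₂ hKW₁ hKtW₁ hQW₁ hT h1 W₂ hKW₂ hKtW₂ hQQW₂ hTc P hS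
  have hP : (kkt K (fromRows (Q₂ * Q₁) P)).det ≠ 0 :=
    det_kkt_oneShot_ne_zero K Q₁ τ₁ W₁ Q₂ τ₂ hKW₁ hKtW₁ hQW₁ hT h1 h2 W₂ hKW₂ hKtW₂ hQQW₂ hTc P hS
  -- take absolute values: the universal sign disappears
  have habs := congrArg (fun x : ℝ => |x|) h
  simp only [abs_mul, abs_pow, abs_neg, abs_one, one_pow, one_mul] at habs
  -- take logarithms of the (positive) factors
  have hd₁ : 0 < |(kkt K (fromRows Q₁ τ₁)).det| := abs_pos.mpr h1.ne_zero
  have hd₂ : 0 < |(kkt (effForm K (fromRows Q₁ τ₁)).toBlocks₁₁ (fromRows Q₂ τ₂)).det| := abs_pos.mpr h2.ne_zero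
  have hdP : 0 < |(kkt K (fromRows (Q₂ * Q₁) P)).det| := abs_pos.mpr hP
  have hT₁ : 0 < |(τ₁ * W₁).det| := abs_pos.mpr hT.ne_zero
  have hT₂ : 0 < |(τ₂ * (Q₁ * W₂)).det| := abs_pos.mpr hTc.ne_zero
  have hSP : 0 < |(P * fromCols W₂ W₁).det| := abs_pos.mpr hS.ne_zero
  have hlog := congrArg Real.log habs
  rw [Real.log_mul hdP.ne' (pow_ne_zero _ (mul_pos hT₁ hT₂).ne'), Real.log_pow, Real.log_mul hT₁.ne' hT₂.ne',
    Real.log_mul (mul_pos hd₁ hd₂).ne' (pow_ne_zero _ hSP.ne'), Real.log_mul hd₁.ne' hd₂.ne', Real.log_pow] at hlog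
  push_cast at hlog
  linarith

end RealLog

end

end Summit.QuantumFields.BalabanUV.Beta.FP.ComposedSliceGhostFactor
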